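import Literature.GroupTheory.CombinatorialGroupTheory.RandomSclFreeGroupProofs
import HarnessLib

/-!
# Random rigidity of scl (Calegari–Walker 2013): proofs, part 3 — inverse repeats (Prop. 2.6)

D. Calegari, A. Walker, *Random rigidity in the free group*, Geom. Topol. 17 (2013)
[CalegariWalker2013], §2.5: for `L > 1` a random reduced word `v` of length `n` has few subwords of
length `Lm` whose INVERSE also occurs in `v` (Prop. 2.6, via Lemma 2.9 — no copy of `σ` overlaps a
copy of `σ⁻¹` — and Lemma 2.10 — conditional on the past, the next window takes any of the `≤ n`
"dangerous" values with probability `≤ n (2k−1)^{−Lm}`), summed over residue classes.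

We prove the FINITE FORM of the residue-class estimate (loc. cit. display after Lemma 2.10):
**`card_filter_inverseRepeatCount_ge_le`** — for windows at positions `s 0 < s 1 < …`
(`s t + (ℓ+1) ≤ s u` for `t < u`), the number of reduced words of length `n` in which at least `a`
of the `T` windows `w[s t, s t + ℓ]` are the inverse of a complete EARLIER window `w[i', i' + ℓ]`
(`i' + ℓ + 1 ≤ s t`) is at most `|F_n| · exp(T p (e^λ − 1) − λ a)` for every `λ ≥ 0`, with
`p = n (2k−1)^{−(ℓ+1)}`: an adapted indicator sum (`Literature.Probability.Moments`) whose
conditional probabilities are bounded by the union over the `≤ n` earlier windows of the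
conditional window bound `card_filter_prefix_window_le` (Lemma 2.10).

Then the combinatorial half of Prop. 2.6: `window_inv_separated` (Lemma 2.9 for windows: a window
equal to the inverse of another window is separated from it), the symmetry `w ↦ w⁻¹` of the set of
reduced words (`card_filter_revInv`) exchanging later and earlier repeats
(`card_laterInverse_eq_card_earlierInverse_revInv`), the residue-class decomposition
(`card_earlierInverse_le_sum_residue`) and pigeonhole (`card_filter_earlierInverse_ge_le`), and
finally **`card_filter_inverseWindows_ge_le`**: the number of reduced words of length `n` with at
least `2(ℓ+1)a` windows of length `ℓ+1` whose inverse is also a window is at most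
`2(ℓ+1) |F_n| exp((n/(ℓ+1)) · n(2k−1)^{−(ℓ+1)} · (e^λ − 1) − λ a)`.
-/

noncomputable section

open Filter

namespace Literature.GroupTheory.CombinatorialGroupTheory

section InverseRepeats

open scoped Classical
open Literature.Probability.Moments

/-- **Lemma 2.10, union form.** Conditional on a reduced past `v` of length `i + 1`, the window of
length `ℓ + 1` starting right after it equals the inverse of one of the complete windows of the past
(the one starting at `i' < i + 1 − ℓ`) for at most `(i + 1 − ℓ) · (2k−1)^{n−(i+1)−(ℓ+1)}` of the
`(2k−1)^{n−(i+1)}` continuations. [cite: CalegariWalker2013, Lemma 2.10] -/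
theorem card_filter_prefix_inverseWindow_le (k i ℓ n : ℕ) (h : i + 1 + (ℓ + 1) ≤ n)
    (v : Fin (i + 1) → Fin k × Bool) :
    (((reducedWords k n).filter fun w => ∀ j : Fin (i + 1), w ⟨j, by omega⟩ = v j).filter
        fun w => ∃ i' : Fin (i + 1 - ℓ), ∀ q : Fin (ℓ + 1),
          w ⟨i + 1 + q, by omega⟩ =
            ((w ⟨i' + (ℓ - q), by omega⟩).1, !(w ⟨i' + (ℓ - q), by omega⟩).2)).card ≤
      (i + 1 - ℓ) * (2 * k - 1) ^ (n - (i + 1) - (ℓ + 1)) := by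
  -- the dangerous values: inverses of the complete windows of the past `v`
  let x : Fin (i + 1 - ℓ) → Fin (ℓ + 1) → Fin k × Bool := fun i' q =>
    ((v ⟨i' + (ℓ - q), by omega⟩).1, !(v ⟨i' + (ℓ - q), by omega⟩).2)
  have hsub : (((reducedWords k n).filter fun w => ∀ j : Fin (i + 1), w ⟨j, by omega⟩ = v j).filter
        fun w => ∃ i' : Fin (i + 1 - ℓ), ∀ q : Fin (ℓ + 1),
          w ⟨i + 1 + q, by omega⟩ =
            ((w ⟨i' + (ℓ - q), by omega⟩).1, !(w ⟨i' + (ℓ - q), by omega⟩).2)) ⊆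
      (Finset.univ : Finset (Fin (i + 1 - ℓ))).biUnion fun i' => (reducedWords k n).filter fun w =>
        (∀ j : Fin (i + 1), w ⟨j, by omega⟩ = v j) ∧
          ∀ q : Fin (ℓ + 1), w ⟨i + 1 + q, by omega⟩ = x i' q := by
    intro w hw
    rw [Finset.mem_filter, Finset.mem_filter] at hw
    obtain ⟨⟨hwred, hwv⟩, i', hwin⟩ := hw
    rw [Finset.mem_biUnion]
    refine ⟨i', Finset.mem_univ _, ?_⟩
    rw [Finset.mem_filter]
    refine ⟨hwred, hwv, fun q => ?_⟩
    rw [hwin q, hwv ⟨i' + (ℓ - q), by omega⟩]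
  refine (Finset.card_le_card hsub).trans (Finset.card_biUnion_le.trans ?_)
  refine (Finset.sum_le_sum fun i' _ => card_filter_prefix_window_le k i ℓ n h v (x i')).trans ?_
  rw [Finset.sum_const, Finset.card_univ, Fintype.card_fin, smul_eq_mul]

/-- **Calegari–Walker Prop. 2.6, residue-class estimate (finite form).** Let `k ≥ 1`, windows of
length `ℓ + 1` at positions `s 0, s 1, …` with `s 0 ≥ 1`, `s t + (ℓ+1) ≤ s u` for `t < u` and
`s t + (ℓ+1) ≤ n` for `t < T`. For `λ ≥ 0` and any `a`, the reduced words of length `n` in which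
at least `a` of the `T` windows `w[s t, s t + ℓ]` equal the inverse of a complete earlier window
`w[i', i'+ℓ]` (`i' < s t − ℓ`) number at most `|F_n| · exp(T p (e^λ − 1) − λ a)`,
`p = n (2k−1)^{−(ℓ+1)}` ("the chance that `v_i⁻¹` is in `S_{<i}` is at most `n^{1−L+ε}`" and
"`Pr(∑_{i ≡ j} … ≥ n^{2−L+ε}/Lm) < O(C^{−n^c})`", loc. cit. Lemma 2.10 and the display after it).
[cite: CalegariWalker2013, Prop. 2.6] -/
theorem card_filter_inverseRepeatCount_ge_le (k n ℓ T : ℕ) (hk : 1 ≤ k) (s : ℕ → ℕ)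
    (hs0 : 1 ≤ s 0) (hs : ∀ t u, t < u → s t + (ℓ + 1) ≤ s u)
    (hsn : ∀ t, t < T → s t + (ℓ + 1) ≤ n) {l : ℝ} (hl : 0 ≤ l) (a : ℝ) :
    (((reducedWords k n).filter fun w => a ≤
        ∑ t : Fin T, if (∃ i' : Fin (s t - ℓ), ∀ q : Fin (ℓ + 1),
            w ⟨s t + q, by have := hsn t t.isLt; omega⟩ =
              ((w ⟨i' + (ℓ - q), by have := hsn t t.isLt; omega⟩).1,
                !(w ⟨i' + (ℓ - q), by have := hsn t t.isLt; omega⟩).2))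
          then (1 : ℝ) else 0).card : ℝ) ≤
      (reducedWords k n).card *
        Real.exp (T * ((n : ℝ) / (2 * k - 1 : ℝ) ^ (ℓ + 1)) * (Real.exp l - 1) - l * a) := by
  set p : ℝ := (n : ℝ) / (2 * k - 1 : ℝ) ^ (ℓ + 1) with hpdef
  have hq1 : (1 : ℝ) ≤ 2 * k - 1 := by
    have : (1 : ℝ) ≤ k := by exact_mod_cast hk
    linarith
  have hqpos : (0 : ℝ) < (2 * k - 1 : ℝ) ^ (ℓ + 1) := by positivity
  have hp : 0 ≤ p := by rw [hpdef]; positivity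
  -- monotonicity of the positions
  have hsmono : ∀ t u, t ≤ u → s t ≤ s u := by
    intro t u htu
    rcases Nat.eq_or_lt_of_le htu with rfl | hlt
    · exact le_rfl
    · have := hs t u hlt; omega
  have hs1 : ∀ t, 1 ≤ s t := fun t => hs0.trans (hsmono 0 t (Nat.zero_le t))
  -- events and keys
  let X : ℕ → (Fin n → Fin k × Bool) → Prop := fun t w =>
    ∃ ht : t < T, ∃ i' : Fin (s t - ℓ), ∀ q : Fin (ℓ + 1),
      w ⟨s t + q, by have := hsn t ht; omega⟩ =
        ((w ⟨i' + (ℓ - q), by have := hsn t ht; omega⟩).1,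
          !(w ⟨i' + (ℓ - q), by have := hsn t ht; omega⟩).2)
  let key : ∀ _ : ℕ, (Fin n → Fin k × Bool) → (Fin n → Option (Fin k × Bool)) := fun t w q =>
    if (q : ℕ) < s t then some (w q) else none
  have hkey0 : ∀ t w w', key t w = key t w' → ∀ q : Fin n, (q : ℕ) < s t → w q = w' q := by
    intro t w w' hww' q hq
    have := congrFun hww' q
    simp only [key, if_pos hq, Option.some.injEq] at this
    exact this
  have hkey : ∀ t, ∀ w ∈ reducedWords k n, ∀ w' ∈ reducedWords k n, key t w = key t w' →
      ∀ u < t, (X u w ↔ X u w') := by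
    intro t w _ w' _ hww' u hut
    have hagree := hkey0 t w w' hww'
    have hsu := hs u t hut
    constructor
    · rintro ⟨hu, i', hw⟩
      refine ⟨hu, i', fun q => ?_⟩
      rw [← hagree _ (by simp; omega), ← hagree _ (by simp; omega)]
      exact hw q
    · rintro ⟨hu, i', hw⟩
      refine ⟨hu, i', fun q => ?_⟩
      rw [hagree _ (by simp; omega), hagree _ (by simp; omega)]
      exact hw q
  -- conditional bound on each fibre
  have hX : ∀ t < T, ∀ v ∈ (reducedWords k n).image (key t),
      (((((reducedWords k n).filter fun w => key t w = v).filter (X t)).card : ℝ)) ≤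
        p * (((reducedWords k n).filter fun w => key t w = v).card : ℝ) := by
    intro t ht v hv
    obtain ⟨w₀, hw₀, rfl⟩ := Finset.mem_image.mp hv
    obtain ⟨i, hi⟩ : ∃ i, s t = i + 1 := ⟨s t - 1, by have := hs1 t; omega⟩
    have hstn : i + 1 + (ℓ + 1) ≤ n := by have := hsn t ht; omega
    set v' : Fin (i + 1) → Fin k × Bool := fun q => w₀ ⟨q, by omega⟩ with hv'
    have hv'red : v' ∈ reducedWords k (i + 1) := prefix_mem_reducedWords (by omega) hw₀
    have hfib : ((reducedWords k n).filter fun w => key t w = key t w₀) =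
        (reducedWords k n).filter fun w => ∀ q : Fin (i + 1), w ⟨q, by omega⟩ = v' q := by
      refine Finset.filter_congr fun w _ => ?_
      constructor
      · intro h' q
        exact hkey0 t w w₀ h' ⟨q, by omega⟩ (by simp; omega)
      · intro h'
        funext q
        show (if (q : ℕ) < s t then some (w q) else none) =
          (if (q : ℕ) < s t then some (w₀ q) else none)
        by_cases hq : (q : ℕ) < s t
        · rw [if_pos hq, if_pos hq, h' ⟨q, by omega⟩]
        · rw [if_neg hq, if_neg hq]
    -- the event on the fibre is contained in the union-form event of Lemma 2.10
    have hev : (((reducedWords k n).filter fun w => key t w = key t w₀).filter (X t)) ⊆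
        ((reducedWords k n).filter fun w => ∀ j : Fin (i + 1), w ⟨j, by omega⟩ = v' j).filter
          fun w => ∃ i' : Fin (i + 1 - ℓ), ∀ q : Fin (ℓ + 1),
            w ⟨i + 1 + q, by omega⟩ =
              ((w ⟨i' + (ℓ - q), by omega⟩).1, !(w ⟨i' + (ℓ - q), by omega⟩).2) := by
      rw [hfib]
      intro w hw
      rw [Finset.mem_filter] at hw ⊢
      obtain ⟨hwv, _, i', hwin⟩ := hw
      refine ⟨hwv, ⟨i', by omega⟩, fun q => ?_⟩
      have e1 : w ⟨i + 1 + q, by omega⟩ = w ⟨s t + q, by have := hsn t ht; omega⟩ :=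
        congrArg w (Fin.ext (show i + 1 + (q : ℕ) = s t + q by omega))
      rw [e1, hwin q]
    have hcard := (Finset.card_le_card hev).trans
      (card_filter_prefix_inverseWindow_le k i ℓ n hstn v')
    have hcardR : ((((reducedWords k n).filter fun w => key t w = key t w₀).filter
        (X t)).card : ℝ) ≤ ((i + 1 - ℓ : ℕ) : ℝ) * (2 * k - 1 : ℝ) ^ (n - (i + 1) - (ℓ + 1)) := by
      have h'' : ((((reducedWords k n).filter fun w => key t w = key t w₀).filter
          (X t)).card : ℝ) ≤ (((i + 1 - ℓ) * (2 * k - 1) ^ (n - (i + 1) - (ℓ + 1)) : ℕ) : ℝ) := by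
        exact_mod_cast hcard
      refine h''.trans (le_of_eq ?_)
      push_cast [Nat.cast_sub (show 1 ≤ 2 * k by omega)]
      ring
    refine hcardR.trans ?_
    rw [hfib, card_filter_prefix' k i n (by omega) v' hv'red]
    have hi1 : ((i + 1 - ℓ : ℕ) : ℝ) ≤ n := by exact_mod_cast (show i + 1 - ℓ ≤ n by omega)
    have hpow : (2 * k - 1 : ℝ) ^ (n - (i + 1) - (ℓ + 1)) * (2 * k - 1 : ℝ) ^ (ℓ + 1) =
        (2 * k - 1 : ℝ) ^ (n - (i + 1)) := by
      rw [← pow_add, show n - (i + 1) - (ℓ + 1) + (ℓ + 1) = n - (i + 1) by omega]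
    rw [hpdef]
    push_cast [Nat.cast_sub (show 1 ≤ 2 * k by omega)]
    rw [div_mul_eq_mul_div, le_div_iff₀ hqpos]
    calc ((i + 1 - ℓ : ℕ) : ℝ) * (2 * k - 1) ^ (n - (i + 1) - (ℓ + 1)) * (2 * k - 1) ^ (ℓ + 1)
        = ((i + 1 - ℓ : ℕ) : ℝ) * (2 * k - 1) ^ (n - (i + 1)) := by rw [mul_assoc, hpow]
      _ ≤ n * (2 * k - 1) ^ (n - (i + 1)) := mul_le_mul_of_nonneg_right hi1 (by positivity)
  -- the adapted Chernoff bound, free `λ`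
  have hmain := card_filter_sum_indicator_ge_le (reducedWords k n) key X hp hkey T hX hl a
  -- identify the sums
  have hsum : ∀ w : Fin n → Fin k × Bool,
      (∑ t ∈ Finset.range T, if X t w then (1 : ℝ) else 0) =
        ∑ t : Fin T, if (∃ i' : Fin (s t - ℓ), ∀ q : Fin (ℓ + 1),
            w ⟨s t + q, by have := hsn t t.isLt; omega⟩ =
              ((w ⟨i' + (ℓ - q), by have := hsn t t.isLt; omega⟩).1,
                !(w ⟨i' + (ℓ - q), by have := hsn t t.isLt; omega⟩).2))
          then (1 : ℝ) else 0 := by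
    intro w
    rw [Finset.sum_range]
    refine Finset.sum_congr rfl fun t _ => ?_
    have hiff : X t w ↔ ∃ i' : Fin (s t - ℓ), ∀ q : Fin (ℓ + 1),
        w ⟨s t + q, by have := hsn t t.isLt; omega⟩ =
          ((w ⟨i' + (ℓ - q), by have := hsn t t.isLt; omega⟩).1,
            !(w ⟨i' + (ℓ - q), by have := hsn t t.isLt; omega⟩).2) :=
      ⟨fun ⟨_, h'⟩ => h', fun h' => ⟨t.isLt, h'⟩⟩
    by_cases hXt : X t w
    · rw [if_pos hXt, if_pos (hiff.mp hXt)]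
    · rw [if_neg hXt, if_neg (fun h' => hXt (hiff.mpr h'))]
  have hfilter : ((reducedWords k n).filter fun w => a ≤
      ∑ t ∈ Finset.range T, if X t w then (1 : ℝ) else 0) =
      (reducedWords k n).filter fun w => a ≤
        ∑ t : Fin T, if (∃ i' : Fin (s t - ℓ), ∀ q : Fin (ℓ + 1),
            w ⟨s t + q, by have := hsn t t.isLt; omega⟩ =
              ((w ⟨i' + (ℓ - q), by have := hsn t t.isLt; omega⟩).1,
                !(w ⟨i' + (ℓ - q), by have := hsn t t.isLt; omega⟩).2))
          then (1 : ℝ) else 0 :=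
    Finset.filter_congr fun w _ => by rw [hsum w]
  rw [hfilter] at hmain
  rw [hpdef] at hmain
  exact hmain

end InverseRepeats

section WindowLists

/-! ### Windows as lists; Lemma 2.9 for windows -/

/-- The window of `w` of length `ℓ + 1` at position `i`, as a list, is `((ofFn w).drop i).take (ℓ+1)`.
[folklore] -/
theorem ofFn_window_eq {A : Type*} {n : ℕ} (w : Fin n → A) (i ℓ : ℕ) (h : i + ℓ + 1 ≤ n) :
    List.ofFn (fun q : Fin (ℓ + 1) => w ⟨i + q, by omega⟩) =
      ((List.ofFn w).drop i).take (ℓ + 1) := by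
  apply List.ext_getElem
  · simp only [List.length_ofFn, List.length_take, List.length_drop]
    omega
  · intro q h1 h2
    simp only [List.getElem_ofFn, List.getElem_take, List.getElem_drop]

/-- Splitting `ofFn w` around the window at `i`. [folklore] -/
theorem ofFn_eq_take_append_window_append_drop {A : Type*} {n : ℕ} (w : Fin n → A) (i ℓ : ℕ)
    (h : i + ℓ + 1 ≤ n) :
    List.ofFn w = (List.ofFn w).take i ++ List.ofFn (fun q : Fin (ℓ + 1) => w ⟨i + q, by omega⟩) ++
      (List.ofFn w).drop (i + (ℓ + 1)) := by
  rw [ofFn_window_eq w i ℓ h, List.append_assoc, ← List.drop_drop, List.take_append_drop,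
    List.take_append_drop]

/-- The inverse of a window, as a list: `invRev` of the window at `i'` is the list
`q ↦ (w (i' + (ℓ − q)))⁻¹`. [folklore] -/
theorem invRev_ofFn_window {α : Type*} {n : ℕ} (w : Fin n → α × Bool) (i' ℓ : ℕ)
    (h : i' + ℓ + 1 ≤ n) :
    FreeGroup.invRev (List.ofFn (fun q : Fin (ℓ + 1) => w ⟨i' + q, by omega⟩)) =
      List.ofFn (fun q : Fin (ℓ + 1) =>
        ((w ⟨i' + (ℓ - q), by omega⟩).1, !(w ⟨i' + (ℓ - q), by omega⟩).2)) := by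
  apply List.ext_getElem
  · simp [FreeGroup.invRev]
  · intro q h1 h2
    simp only [FreeGroup.invRev, List.getElem_reverse, List.getElem_map, List.getElem_ofFn,
      List.length_map, List.length_ofFn]
    rw [show (⟨i' + (ℓ + 1 - 1 - q), _⟩ : Fin n) = ⟨i' + (ℓ - q), by omega⟩ from
      Fin.ext (by simp only; omega)]

/-- **Lemma 2.9 for windows.** In a reduced word, a window of length `ℓ + 1` at `i` that equals
the inverse of the window at `i'` is separated from it: `i + ℓ + 1 < i'` or `i' + ℓ + 1 < i`.
[cite: CalegariWalker2013, Lemma 2.9] -/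
theorem window_inv_separated {k n ℓ : ℕ} {w : Fin n → Fin k × Bool} (hw : w ∈ reducedWords k n)
    {i i' : ℕ} (hi : i + ℓ + 1 ≤ n) (hi' : i' + ℓ + 1 ≤ n)
    (h : ∀ q : Fin (ℓ + 1), w ⟨i + q, by omega⟩ =
      ((w ⟨i' + (ℓ - q), by omega⟩).1, !(w ⟨i' + (ℓ - q), by omega⟩).2)) :
    i + ℓ + 1 < i' ∨ i' + ℓ + 1 < i := by
  have hred : FreeGroup.IsReduced (List.ofFn w) :=
    FreeGroup.isReduced_iff_reduce_eq.mpr ((mem_reducedWords_iff w).mp hw)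
  set σ := List.ofFn (fun q : Fin (ℓ + 1) => w ⟨i' + q, by omega⟩) with hσ
  have hσne : σ ≠ [] := by
    rw [hσ, ne_eq, List.ofFn_eq_nil_iff]
    omega
  have h₁ := ofFn_eq_take_append_window_append_drop w i' ℓ hi'
  have hwin : List.ofFn (fun q : Fin (ℓ + 1) => w ⟨i + q, by omega⟩) = FreeGroup.invRev σ := by
    rw [hσ, invRev_ofFn_window w i' ℓ hi']
    exact congrArg List.ofFn (funext h)
  have h₂ := ofFn_eq_take_append_window_append_drop w i ℓ hi
  rw [hwin] at h₂
  have hsep := inv_occurrences_separated hred hσne h₁ h₂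
  simp only [List.length_take, List.length_ofFn, hσ] at hsep
  omega

end WindowLists

section Reversal

open scoped Classical

/-! ### The symmetry `w ↦ w⁻¹` (read backwards and invert letters) of the set of reduced words -/

/-- Letters of `w⁻¹ = (q ↦ (w (rev q))⁻¹)` at a numeric position. [folklore] -/
theorem revInv_apply_mk {α : Type*} {n : ℕ} (w : Fin n → α × Bool) (a : ℕ) (ha : a < n) :
    (fun q : Fin n => ((w (Fin.rev q)).1, !(w (Fin.rev q)).2)) ⟨a, ha⟩ =
      ((w ⟨n - 1 - a, by omega⟩).1, !(w ⟨n - 1 - a, by omega⟩).2) := by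
  have : Fin.rev (⟨a, ha⟩ : Fin n) = ⟨n - 1 - a, by omega⟩ :=
    Fin.ext (by simp only [Fin.val_rev]; omega)
  simp only [this]

/-- `w⁻¹` is again reduced. [folklore] -/
theorem revInv_mem_reducedWords {k n : ℕ} {w : Fin n → Fin k × Bool} (hw : w ∈ reducedWords k n) :
    (fun q : Fin n => ((w (Fin.rev q)).1, !(w (Fin.rev q)).2)) ∈ reducedWords k n := by
  rw [mem_reducedWords_iff, reduce_ofFn_eq_self_iff] at hw ⊢
  intro i hi h1
  have hr : ∀ (a : ℕ) (ha : a < n), w (Fin.rev ⟨a, ha⟩) = w ⟨n - 1 - a, by omega⟩ :=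
    fun a ha => congrArg w (Fin.ext (by simp only [Fin.val_rev]; omega))
  simp only [hr, Bool.not_inj_iff] at h1 ⊢
  have e : (⟨n - 1 - i, by omega⟩ : Fin n) = ⟨n - 1 - (i + 1) + 1, by omega⟩ :=
    Fin.ext (show n - 1 - i = n - 1 - (i + 1) + 1 by omega)
  rw [e] at h1 ⊢
  exact (hw (n - 1 - (i + 1)) (by omega) h1.symm).symm

/-- `w ↦ w⁻¹` is an involution. [folklore] -/
theorem revInv_revInv {α : Type*} {n : ℕ} (w : Fin n → α × Bool) :
    (fun q : Fin n => (((fun q' : Fin n => ((w (Fin.rev q')).1, !(w (Fin.rev q')).2)) (Fin.rev q)).1,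
      !((fun q' : Fin n => ((w (Fin.rev q')).1, !(w (Fin.rev q')).2)) (Fin.rev q)).2)) = w := by
  funext q
  simp [Fin.rev_rev]

/-- The uniform measure on reduced words is invariant under `w ↦ w⁻¹`: for every property `P`,
`#{w ∈ F_n : P(w⁻¹)} = #{w ∈ F_n : P(w)}`. [folklore] -/
theorem card_filter_revInv {k n : ℕ} (P : (Fin n → Fin k × Bool) → Prop) :
    ((reducedWords k n).filter fun w =>
        P (fun q : Fin n => ((w (Fin.rev q)).1, !(w (Fin.rev q)).2))).card =
      ((reducedWords k n).filter P).card := by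
  refine Finset.card_bij' (fun w _ => fun q : Fin n => ((w (Fin.rev q)).1, !(w (Fin.rev q)).2))
    (fun w _ => fun q : Fin n => ((w (Fin.rev q)).1, !(w (Fin.rev q)).2)) ?_ ?_ ?_ ?_
  · intro w hw
    rw [Finset.mem_filter] at hw ⊢
    exact ⟨revInv_mem_reducedWords hw.1, hw.2⟩
  · intro w hw
    rw [Finset.mem_filter] at hw ⊢
    refine ⟨revInv_mem_reducedWords hw.1, ?_⟩
    rw [revInv_revInv w]
    exact hw.2
  · intro w _
    exact revInv_revInv w
  · intro w _
    exact revInv_revInv w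

/-- **Later inverse repeats of `w` = earlier inverse repeats of `w⁻¹`.** The number of windows
`w[i, i+ℓ]` equal to the inverse of a complete LATER window `w[i', i'+ℓ]` (`i' ≥ i + ℓ + 1`) equals
the number of windows of `w⁻¹` equal to the inverse of a complete EARLIER window (position
`i ↦ n − ℓ − 1 − i`). [cite: CalegariWalker2013, proof of Prop. 2.6 ("by symmetry")] -/
theorem card_laterInverse_eq_card_earlierInverse_revInv {α : Type*} [DecidableEq α] {n ℓ : ℕ}
    (w : Fin n → α × Bool) :
    ((Finset.univ : Finset (Fin (n - ℓ))).filter fun i : Fin (n - ℓ) => ∃ i' : Fin (n - ℓ),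
        (i : ℕ) + ℓ + 1 ≤ i' ∧ ∀ q : Fin (ℓ + 1), w ⟨i + q, by omega⟩ =
          ((w ⟨i' + (ℓ - q), by omega⟩).1, !(w ⟨i' + (ℓ - q), by omega⟩).2)).card =
    ((Finset.univ : Finset (Fin (n - ℓ))).filter fun J : Fin (n - ℓ) => ∃ J' : Fin (J - ℓ),
        ∀ q : Fin (ℓ + 1),
          (fun q : Fin n => ((w (Fin.rev q)).1, !(w (Fin.rev q)).2)) ⟨J + q, by omega⟩ =
          (((fun q : Fin n => ((w (Fin.rev q)).1, !(w (Fin.rev q)).2)) ⟨J' + (ℓ - q), by omega⟩).1,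
            !((fun q : Fin n => ((w (Fin.rev q)).1, !(w (Fin.rev q)).2))
              ⟨J' + (ℓ - q), by omega⟩).2)).card := by
  -- the two events correspond under `i ↦ J = n - ℓ - 1 - i`
  have key : ∀ (i J : Fin (n - ℓ)), (J : ℕ) = n - ℓ - 1 - i →
      ((∃ i' : Fin (n - ℓ), (i : ℕ) + ℓ + 1 ≤ i' ∧ ∀ q : Fin (ℓ + 1), w ⟨i + q, by omega⟩ =
          ((w ⟨i' + (ℓ - q), by omega⟩).1, !(w ⟨i' + (ℓ - q), by omega⟩).2)) ↔
      (∃ J' : Fin ((J : ℕ) - ℓ), ∀ q : Fin (ℓ + 1),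
          (fun q : Fin n => ((w (Fin.rev q)).1, !(w (Fin.rev q)).2)) ⟨(J : ℕ) + q, by omega⟩ =
          (((fun q : Fin n => ((w (Fin.rev q)).1, !(w (Fin.rev q)).2))
              ⟨J' + (ℓ - q), by omega⟩).1,
            !((fun q : Fin n => ((w (Fin.rev q)).1, !(w (Fin.rev q)).2))
              ⟨J' + (ℓ - q), by omega⟩).2))) := by
    intro i J hJ
    have hnpos : 0 < n := by omega
    -- letters at numeric positions, proof-free
    let W : ℕ → α × Bool := fun a => if h : a < n then w ⟨a, h⟩ else w ⟨0, hnpos⟩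
    have hwW : ∀ (a : ℕ) (ha : a < n), w ⟨a, ha⟩ = W a := fun a ha => by simp [W, ha]
    constructor
    · rintro ⟨i', hii', hq⟩
      refine ⟨⟨n - ℓ - 1 - i', by omega⟩, fun q => ?_⟩
      rw [revInv_apply_mk w _ (by omega), revInv_apply_mk w _ (by omega)]
      simp only [Bool.not_not, Prod.mk.eta, hwW]
      have h' := hq ⟨ℓ - q, by omega⟩
      simp only [hwW] at h'
      rw [show n - 1 - ((J : ℕ) + q) = i + (ℓ - q) by omega, h',
        show (i' : ℕ) + (ℓ - (ℓ - (q : ℕ))) = n - 1 - ((n - ℓ - 1 - i') + (ℓ - q)) by omega]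
      simp
    · rintro ⟨J', hq⟩
      refine ⟨⟨n - ℓ - 1 - J', by omega⟩, by simp only; omega, fun q => ?_⟩
      have h' := hq ⟨ℓ - q, by omega⟩
      rw [revInv_apply_mk w _ (by omega), revInv_apply_mk w _ (by omega)] at h'
      simp only [Bool.not_not, Prod.mk.eta, hwW] at h' ⊢
      rw [show (i : ℕ) + q = n - 1 - ((J : ℕ) + (ℓ - q)) by omega,
        show n - ℓ - 1 - (J' : ℕ) + (ℓ - q) = n - 1 - ((J' : ℕ) + (ℓ - (ℓ - (q : ℕ)))) by omega,
        ← h']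
      simp
  refine Finset.card_bij' (fun i _ => Fin.rev i) (fun J _ => Fin.rev J) ?_ ?_ ?_ ?_
  · intro i hi
    rw [Finset.mem_filter] at hi ⊢
    exact ⟨Finset.mem_univ _, (key i (Fin.rev i) (by rw [Fin.val_rev]; omega)).mp hi.2⟩
  · intro J hJ
    rw [Finset.mem_filter] at hJ ⊢
    exact ⟨Finset.mem_univ _, (key (Fin.rev J) J (by rw [Fin.val_rev]; omega)).mpr hJ.2⟩
  · intro i _
    exact Fin.rev_rev i
  · intro J _
    exact Fin.rev_rev J

end Reversal

section Assembly

open scoped Classical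
open Literature.Probability.Moments

/-! ### Prop. 2.6, finite form: all windows, both directions -/

/-- Transport of the "inverse of an earlier window" event along an equality of positions.
[folklore] -/
private theorem earlierEvent_congr {α : Type*} {n ℓ : ℕ} (w : Fin n → α × Bool) (a b : ℕ)
    (hab : a = b) (ha : a + ℓ + 1 ≤ n) (hb : b + ℓ + 1 ≤ n) :
    (∃ J' : Fin (a - ℓ), ∀ q : Fin (ℓ + 1), w ⟨a + q, by omega⟩ =
        ((w ⟨J' + (ℓ - q), by omega⟩).1, !(w ⟨J' + (ℓ - q), by omega⟩).2)) ↔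
      (∃ J' : Fin (b - ℓ), ∀ q : Fin (ℓ + 1), w ⟨b + q, by omega⟩ =
        ((w ⟨J' + (ℓ - q), by omega⟩).1, !(w ⟨J' + (ℓ - q), by omega⟩).2)) := by
  subst hab
  exact Iff.rfl

/-- Positions along the residue class `j`: `j + 1 + t (ℓ+1)` is a legal window start for
`t < (n − (j+1)) / (ℓ+1)`. [folklore] -/
private theorem residue_pos_le {n ℓ j : ℕ} (t : Fin ((n - (j + 1)) / (ℓ + 1))) :
    j + 1 + (t : ℕ) * (ℓ + 1) + (ℓ + 1) ≤ n := by
  have h1 : (t : ℕ) + 1 ≤ (n - (j + 1)) / (ℓ + 1) := Nat.succ_le_of_lt t.isLt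
  have h2 := (Nat.le_div_iff_mul_le (show 0 < ℓ + 1 by omega)).mp h1
  rw [add_mul, one_mul] at h2
  omega

/-- **Residue-class decomposition.** The number of windows of `w` (at any position `J < n − ℓ`)
equal to the inverse of a complete earlier window is at most the sum over `j < ℓ + 1` of the
counts along the arithmetic progressions `J = j + 1 + t (ℓ+1)`, `t < (n − (j+1)) / (ℓ+1)`.
[cite: CalegariWalker2013, proof of Prop. 2.6] -/
theorem card_earlierInverse_le_sum_residue {α : Type*} [DecidableEq α] {n ℓ : ℕ}
    (w : Fin n → α × Bool) :
    (((Finset.univ : Finset (Fin (n - ℓ))).filter fun J : Fin (n - ℓ) => ∃ J' : Fin (J - ℓ),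
        ∀ q : Fin (ℓ + 1), w ⟨J + q, by omega⟩ =
          ((w ⟨J' + (ℓ - q), by omega⟩).1, !(w ⟨J' + (ℓ - q), by omega⟩).2)).card : ℝ) ≤
      ∑ j ∈ Finset.range (ℓ + 1), ∑ t : Fin ((n - (j + 1)) / (ℓ + 1)),
        if (∃ i' : Fin (j + 1 + (t : ℕ) * (ℓ + 1) - ℓ), ∀ q : Fin (ℓ + 1),
            w ⟨j + 1 + (t : ℕ) * (ℓ + 1) + q, by have := residue_pos_le t; omega⟩ =
              ((w ⟨i' + (ℓ - q), by have := residue_pos_le t; omega⟩).1,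
                !(w ⟨i' + (ℓ - q), by have := residue_pos_le t; omega⟩).2))
          then (1 : ℝ) else 0 := by
  -- abbreviations
  set E : Fin (n - ℓ) → Prop := fun J => ∃ J' : Fin (J - ℓ), ∀ q : Fin (ℓ + 1),
      w ⟨J + q, by omega⟩ = ((w ⟨J' + (ℓ - q), by omega⟩).1, !(w ⟨J' + (ℓ - q), by omega⟩).2)
    with hE
  set E' : ∀ j : ℕ, Fin ((n - (j + 1)) / (ℓ + 1)) → Prop := fun j t =>
      ∃ i' : Fin (j + 1 + (t : ℕ) * (ℓ + 1) - ℓ), ∀ q : Fin (ℓ + 1),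
        w ⟨j + 1 + (t : ℕ) * (ℓ + 1) + q, by have := residue_pos_le t; omega⟩ =
          ((w ⟨i' + (ℓ - q), by have := residue_pos_le t; omega⟩).1,
            !(w ⟨i' + (ℓ - q), by have := residue_pos_le t; omega⟩).2) with hE'
  -- the right-hand side is a sum of cardinalities
  have hrhs : ∀ j ∈ Finset.range (ℓ + 1),
      (∑ t : Fin ((n - (j + 1)) / (ℓ + 1)), if E' j t then (1 : ℝ) else 0) =
        ((Finset.univ.filter (E' j)).card : ℝ) := by
    intro j _
    rw [Finset.sum_boole]
  rw [Finset.sum_congr rfl hrhs]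
  -- E J forces J ≥ ℓ + 1 ≥ 1
  have hEpos : ∀ J : Fin (n - ℓ), E J → ℓ + 1 ≤ (J : ℕ) := by
    rintro J ⟨J', _⟩
    have := J'.isLt
    omega
  -- fibrewise over the residue of `J - 1`
  have hfib := Finset.card_eq_sum_card_fiberwise (s := Finset.univ.filter E)
    (t := Finset.range (ℓ + 1)) (f := fun J : Fin (n - ℓ) => ((J : ℕ) - 1) % (ℓ + 1))
    (fun J _ => Finset.mem_range.mpr (Nat.mod_lt _ (Nat.succ_pos ℓ)))
  have hle : ∀ j ∈ Finset.range (ℓ + 1),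
      ((Finset.univ.filter E).filter fun J : Fin (n - ℓ) => ((J : ℕ) - 1) % (ℓ + 1) = j).card ≤
        (Finset.univ.filter (E' j)).card := by
    intro j hj
    -- the fibre is contained in the image of `t ↦ j + 1 + t (ℓ+1)`
    have hsub : ((Finset.univ.filter E).filter fun J : Fin (n - ℓ) =>
        ((J : ℕ) - 1) % (ℓ + 1) = j) ⊆
        (Finset.univ.filter (E' j)).image fun t : Fin ((n - (j + 1)) / (ℓ + 1)) =>
          (⟨j + 1 + (t : ℕ) * (ℓ + 1), by have := residue_pos_le t; omega⟩ : Fin (n - ℓ)) := by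
      intro J hJ
      rw [Finset.mem_filter, Finset.mem_filter] at hJ
      obtain ⟨⟨_, hEJ⟩, hres⟩ := hJ
      have hJ1 := hEpos J hEJ
      have hJlt := J.isLt
      have hdm : ((J : ℕ) - 1) / (ℓ + 1) * (ℓ + 1) + j = (J : ℕ) - 1 := by
        rw [Nat.mul_comm, ← hres]
        exact Nat.div_add_mod _ _
      -- the quotient is a legal index
      have htlt : ((J : ℕ) - 1) / (ℓ + 1) < (n - (j + 1)) / (ℓ + 1) := by
        refine Nat.lt_of_succ_le ((Nat.le_div_iff_mul_le (show 0 < ℓ + 1 by omega)).mpr ?_)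
        rw [Nat.succ_mul]
        omega
      have hpos : j + 1 + ((J : ℕ) - 1) / (ℓ + 1) * (ℓ + 1) = J := by omega
      rw [Finset.mem_image]
      refine ⟨⟨((J : ℕ) - 1) / (ℓ + 1), htlt⟩, ?_, Fin.ext hpos⟩
      rw [Finset.mem_filter]
      refine ⟨Finset.mem_univ _, ?_⟩
      exact (earlierEvent_congr w _ _ hpos (by omega) (by omega)).mpr hEJ
    exact (Finset.card_le_card hsub).trans Finset.card_image_le
  change (((Finset.univ.filter E).card : ℕ) : ℝ) ≤ _
  rw [hfib]
  push_cast
  exact Finset.sum_le_sum fun j hj => by exact_mod_cast hle j hj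


/-- **Calegari–Walker Prop. 2.6, earlier repeats over all positions (finite form).** For `k ≥ 1`,
`λ ≥ 0` and any `a`: the reduced words of length `n` having at least `(ℓ+1)·a` windows (at any
position) equal to the inverse of a complete earlier window number at most
`(ℓ+1) · |F_n| · exp((n/(ℓ+1)) · p · (e^λ − 1) − λ a)`, `p = n (2k−1)^{−(ℓ+1)}` (pigeonhole over
the `ℓ + 1` residue classes and `card_filter_inverseRepeatCount_ge_le`).
[cite: CalegariWalker2013, Prop. 2.6] -/
theorem card_filter_earlierInverse_ge_le (k n ℓ : ℕ) (hk : 1 ≤ k) {l : ℝ} (hl : 0 ≤ l) (a : ℝ) :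
    (((reducedWords k n).filter fun w => ((ℓ : ℝ) + 1) * a ≤
        (((Finset.univ : Finset (Fin (n - ℓ))).filter fun J : Fin (n - ℓ) => ∃ J' : Fin (J - ℓ),
          ∀ q : Fin (ℓ + 1), w ⟨J + q, by omega⟩ =
            ((w ⟨J' + (ℓ - q), by omega⟩).1, !(w ⟨J' + (ℓ - q), by omega⟩).2)).card : ℝ)).card
        : ℝ) ≤
      ((ℓ : ℝ) + 1) * (reducedWords k n).card *
        Real.exp ((n : ℝ) / ((ℓ : ℝ) + 1) * ((n : ℝ) / (2 * k - 1 : ℝ) ^ (ℓ + 1)) *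
          (Real.exp l - 1) - l * a) := by
  -- the class counts
  set C : ℕ → (Fin n → Fin k × Bool) → ℝ := fun j w => ∑ t : Fin ((n - (j + 1)) / (ℓ + 1)),
      if (∃ i' : Fin (j + 1 + (t : ℕ) * (ℓ + 1) - ℓ), ∀ q : Fin (ℓ + 1),
          w ⟨j + 1 + (t : ℕ) * (ℓ + 1) + q, by have := residue_pos_le t; omega⟩ =
            ((w ⟨i' + (ℓ - q), by have := residue_pos_le t; omega⟩).1,
              !(w ⟨i' + (ℓ - q), by have := residue_pos_le t; omega⟩).2))
        then (1 : ℝ) else 0 with hC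
  have hq1 : (1 : ℝ) ≤ 2 * k - 1 := by
    have : (1 : ℝ) ≤ k := by exact_mod_cast hk
    linarith
  have hel : 0 ≤ Real.exp l - 1 := by linarith [Real.add_one_le_exp l, Real.exp_pos l]
  have hp : (0 : ℝ) ≤ (n : ℝ) / (2 * k - 1 : ℝ) ^ (ℓ + 1) := by positivity
  -- Step 1: pigeonhole over residues
  have hsub : ((reducedWords k n).filter fun w => ((ℓ : ℝ) + 1) * a ≤
      (((Finset.univ : Finset (Fin (n - ℓ))).filter fun J : Fin (n - ℓ) => ∃ J' : Fin (J - ℓ),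
        ∀ q : Fin (ℓ + 1), w ⟨J + q, by omega⟩ =
          ((w ⟨J' + (ℓ - q), by omega⟩).1, !(w ⟨J' + (ℓ - q), by omega⟩).2)).card : ℝ)) ⊆
      (Finset.range (ℓ + 1)).biUnion fun j => (reducedWords k n).filter fun w => a ≤ C j w := by
    intro w hw
    rw [Finset.mem_filter] at hw
    obtain ⟨hwred, hwa⟩ := hw
    have hdec := card_earlierInverse_le_sum_residue (ℓ := ℓ) w
    have hdec' : (((Finset.univ : Finset (Fin (n - ℓ))).filter fun J : Fin (n - ℓ) =>
        ∃ J' : Fin (J - ℓ), ∀ q : Fin (ℓ + 1), w ⟨J + q, by omega⟩ =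
          ((w ⟨J' + (ℓ - q), by omega⟩).1, !(w ⟨J' + (ℓ - q), by omega⟩).2)).card : ℝ) ≤
        ∑ j ∈ Finset.range (ℓ + 1), C j w := hdec
    rw [Finset.mem_biUnion]
    by_contra hcon
    have hlt : ∀ j ∈ Finset.range (ℓ + 1), C j w < a := fun j hj =>
      lt_of_not_ge fun hge => hcon ⟨j, hj, Finset.mem_filter.mpr ⟨hwred, hge⟩⟩
    have hsum : ∑ j ∈ Finset.range (ℓ + 1), C j w < ∑ _j ∈ Finset.range (ℓ + 1), a :=
      Finset.sum_lt_sum_of_nonempty ⟨0, by simp⟩ hlt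
    rw [Finset.sum_const, Finset.card_range, nsmul_eq_mul] at hsum
    push_cast at hsum
    linarith
  have hcard1 := (Finset.card_le_card hsub).trans Finset.card_biUnion_le
  have hcard1' := (Nat.cast_le (α := ℝ)).mpr hcard1
  rw [Nat.cast_sum] at hcard1'
  refine hcard1'.trans ?_
  -- Step 2: each residue class by the adapted Chernoff bound
  have hclass : ∀ j ∈ Finset.range (ℓ + 1),
      (((reducedWords k n).filter fun w => a ≤ C j w).card : ℝ) ≤
        (reducedWords k n).card * Real.exp ((n : ℝ) / ((ℓ : ℝ) + 1) *
          ((n : ℝ) / (2 * k - 1 : ℝ) ^ (ℓ + 1)) * (Real.exp l - 1) - l * a) := by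
    intro j _
    have hs0 : 1 ≤ (fun t : ℕ => j + 1 + t * (ℓ + 1)) 0 := by
      show 1 ≤ j + 1 + 0 * (ℓ + 1)
      omega
    have hs : ∀ t u : ℕ, t < u → (fun t : ℕ => j + 1 + t * (ℓ + 1)) t + (ℓ + 1) ≤
        (fun t : ℕ => j + 1 + t * (ℓ + 1)) u := by
      intro t u htu
      show j + 1 + t * (ℓ + 1) + (ℓ + 1) ≤ j + 1 + u * (ℓ + 1)
      have := Nat.mul_le_mul_right (ℓ + 1) (Nat.succ_le_of_lt htu)
      rw [Nat.succ_mul] at this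
      omega
    have hsn : ∀ t : ℕ, t < (n - (j + 1)) / (ℓ + 1) →
        (fun t : ℕ => j + 1 + t * (ℓ + 1)) t + (ℓ + 1) ≤ n := by
      intro t ht
      exact residue_pos_le (⟨t, ht⟩ : Fin ((n - (j + 1)) / (ℓ + 1)))
    have hB := card_filter_inverseRepeatCount_ge_le k n ℓ ((n - (j + 1)) / (ℓ + 1)) hk
      (fun t : ℕ => j + 1 + t * (ℓ + 1)) hs0 hs hsn hl a
    refine hB.trans (mul_le_mul_of_nonneg_left (Real.exp_le_exp.mpr ?_) (Nat.cast_nonneg _))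
    have hT : (((n - (j + 1)) / (ℓ + 1) : ℕ) : ℝ) ≤ (n : ℝ) / ((ℓ : ℝ) + 1) := by
      refine (Nat.cast_div_le).trans ?_
      push_cast
      exact div_le_div_of_nonneg_right (by exact_mod_cast Nat.sub_le n (j + 1)) (by positivity)
    have := mul_le_mul_of_nonneg_right hT (mul_nonneg hp hel)
    nlinarith
  calc ∑ j ∈ Finset.range (ℓ + 1), (((reducedWords k n).filter fun w => a ≤ C j w).card : ℝ)
      ≤ ∑ _j ∈ Finset.range (ℓ + 1), (reducedWords k n).card * Real.exp ((n : ℝ) / ((ℓ : ℝ) + 1) *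
          ((n : ℝ) / (2 * k - 1 : ℝ) ^ (ℓ + 1)) * (Real.exp l - 1) - l * a) :=
        Finset.sum_le_sum hclass
    _ = ((ℓ : ℝ) + 1) * (reducedWords k n).card *
        Real.exp ((n : ℝ) / ((ℓ : ℝ) + 1) * ((n : ℝ) / (2 * k - 1 : ℝ) ^ (ℓ + 1)) *
          (Real.exp l - 1) - l * a) := by
        rw [Finset.sum_const, Finset.card_range, nsmul_eq_mul]
        push_cast
        ring

/-- **Lemma 2.9 ⇒ every inverse pair of windows is an earlier or a later repeat.** For a reduced
word, the number of windows equal to the inverse of SOME window of `w` is at most the number of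
windows equal to the inverse of a complete earlier window plus the number equal to the inverse of
a complete later window. [cite: CalegariWalker2013, proof of Prop. 2.6] -/
theorem card_inverseWindows_le {k n ℓ : ℕ} {w : Fin n → Fin k × Bool}
    (hw : w ∈ reducedWords k n) :
    ((Finset.univ : Finset (Fin (n - ℓ))).filter fun i : Fin (n - ℓ) => ∃ i' : Fin (n - ℓ),
        ∀ q : Fin (ℓ + 1), w ⟨i + q, by omega⟩ =
          ((w ⟨i' + (ℓ - q), by omega⟩).1, !(w ⟨i' + (ℓ - q), by omega⟩).2)).card ≤
      ((Finset.univ : Finset (Fin (n - ℓ))).filter fun J : Fin (n - ℓ) => ∃ J' : Fin (J - ℓ),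
        ∀ q : Fin (ℓ + 1), w ⟨J + q, by omega⟩ =
          ((w ⟨J' + (ℓ - q), by omega⟩).1, !(w ⟨J' + (ℓ - q), by omega⟩).2)).card +
      ((Finset.univ : Finset (Fin (n - ℓ))).filter fun i : Fin (n - ℓ) => ∃ i' : Fin (n - ℓ),
        (i : ℕ) + ℓ + 1 ≤ i' ∧ ∀ q : Fin (ℓ + 1), w ⟨i + q, by omega⟩ =
          ((w ⟨i' + (ℓ - q), by omega⟩).1, !(w ⟨i' + (ℓ - q), by omega⟩).2)).card := by
  refine le_trans (Finset.card_le_card ?_) (Finset.card_union_le _ _)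
  intro i hi
  rw [Finset.mem_filter] at hi
  obtain ⟨_, i', h⟩ := hi
  rw [Finset.mem_union, Finset.mem_filter, Finset.mem_filter]
  rcases window_inv_separated (ℓ := ℓ) hw (i := i) (i' := i') (by omega) (by omega) h with
    hlt | hlt
  · exact Or.inr ⟨Finset.mem_univ _, i', by omega, h⟩
  · exact Or.inl ⟨Finset.mem_univ _, ⟨i', by omega⟩, h⟩

/-- **Calegari–Walker Prop. 2.6 (finite form).** For `k ≥ 1`, a window length `ℓ + 1`, `λ ≥ 0`
and any `a`: the number of reduced words `w` of length `n` with at least `2(ℓ+1)·a` windows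
`w[i, i+ℓ]` whose inverse is also a window of `w` is at most
`2(ℓ+1) · |F_n| · exp((n/(ℓ+1)) · n(2k−1)^{−(ℓ+1)} · (e^λ − 1) − λ a)`.
(With `ℓ + 1 = Lm`, `L > 1`, `a = n^{2−L+ε}/(2Lm)`, `λ = 1` this is `O(|F_n| C^{−n^c})`, and
`∑_{σ ∈ S} C_σ(w⁻¹)` for `S` a set of windows of `w` is at most the number of such windows.)
[cite: CalegariWalker2013, Prop. 2.6] -/
theorem card_filter_inverseWindows_ge_le (k n ℓ : ℕ) (hk : 1 ≤ k) {l : ℝ} (hl : 0 ≤ l) (a : ℝ) :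
    (((reducedWords k n).filter fun w => 2 * (((ℓ : ℝ) + 1) * a) ≤
        (((Finset.univ : Finset (Fin (n - ℓ))).filter fun i : Fin (n - ℓ) => ∃ i' : Fin (n - ℓ),
          ∀ q : Fin (ℓ + 1), w ⟨i + q, by omega⟩ =
            ((w ⟨i' + (ℓ - q), by omega⟩).1, !(w ⟨i' + (ℓ - q), by omega⟩).2)).card : ℝ)).card
        : ℝ) ≤
      2 * (((ℓ : ℝ) + 1) * (reducedWords k n).card *
        Real.exp ((n : ℝ) / ((ℓ : ℝ) + 1) * ((n : ℝ) / (2 * k - 1 : ℝ) ^ (ℓ + 1)) *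
          (Real.exp l - 1) - l * a)) := by
  -- the earlier-repeat threshold property, as a property of words
  set P : (Fin n → Fin k × Bool) → Prop := fun u => ((ℓ : ℝ) + 1) * a ≤
      (((Finset.univ : Finset (Fin (n - ℓ))).filter fun J : Fin (n - ℓ) => ∃ J' : Fin (J - ℓ),
        ∀ q : Fin (ℓ + 1), u ⟨J + q, by omega⟩ =
          ((u ⟨J' + (ℓ - q), by omega⟩).1, !(u ⟨J' + (ℓ - q), by omega⟩).2)).card : ℝ) with hP
  have hE := card_filter_earlierInverse_ge_le k n ℓ hk hl a
  have hL : (((reducedWords k n).filter fun w =>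
      P (fun q : Fin n => ((w (Fin.rev q)).1, !(w (Fin.rev q)).2))).card : ℝ) ≤
      ((ℓ : ℝ) + 1) * (reducedWords k n).card *
        Real.exp ((n : ℝ) / ((ℓ : ℝ) + 1) * ((n : ℝ) / (2 * k - 1 : ℝ) ^ (ℓ + 1)) *
          (Real.exp l - 1) - l * a) := by
    rw [card_filter_revInv P]
    exact hE
  have hsub : ((reducedWords k n).filter fun w => 2 * (((ℓ : ℝ) + 1) * a) ≤
      (((Finset.univ : Finset (Fin (n - ℓ))).filter fun i : Fin (n - ℓ) => ∃ i' : Fin (n - ℓ),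
        ∀ q : Fin (ℓ + 1), w ⟨i + q, by omega⟩ =
          ((w ⟨i' + (ℓ - q), by omega⟩).1, !(w ⟨i' + (ℓ - q), by omega⟩).2)).card : ℝ)) ⊆
      (reducedWords k n).filter P ∪
        (reducedWords k n).filter fun w =>
          P (fun q : Fin n => ((w (Fin.rev q)).1, !(w (Fin.rev q)).2)) := by
    intro w hw
    rw [Finset.mem_filter] at hw
    obtain ⟨hwred, hwa⟩ := hw
    have htot0 := card_inverseWindows_le (ℓ := ℓ) hwred
    have hRL := card_laterInverse_eq_card_earlierInverse_revInv (ℓ := ℓ) w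
    have htot := htot0.trans (le_of_eq (congrArg _ hRL))
    have htot' := (Nat.cast_le (α := ℝ)).mpr htot
    rw [Nat.cast_add] at htot'
    rw [Finset.mem_union, Finset.mem_filter, Finset.mem_filter]
    by_contra hcon
    rw [not_or, not_and, not_and] at hcon
    have h1 := lt_of_not_ge (hcon.1 hwred)
    have h2 := lt_of_not_ge (hcon.2 hwred)
    linarith
  have hcard := (Finset.card_le_card hsub).trans (Finset.card_union_le _ _)
  have hcard' := (Nat.cast_le (α := ℝ)).mpr hcard
  rw [Nat.cast_add] at hcard'
  refine hcard'.trans ?_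
  rw [two_mul]
  exact add_le_add hE hL

end Assembly

end Literature.GroupTheory.CombinatorialGroupTheory

end
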